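import Summits.CriticalPhenomena.PercolationContinuityZ3.Theorems.PercAnnulusCrossingIICTailTrivial
import Summits.CriticalPhenomena.PercolationContinuityZ3.Theorems.PercAnnulusCrossingIICBushes
import HarnessLib

/-!
# A zero-one law for the recurrence of Kesten's IIC to receding sets (lane RSW3, p1 gen 14)

builds on p205010 (kernel theorem, internal audit signed; external expert review pending) — used through `θ(p_c) = 0`
(`CSH.percolationContinuity_allDimensions`, via gen 10's tail triviality) in the `criticalProbI` statements; `ℤ²` unconditional.

Seat `prim-rsw3-p1` (gen 14); memo `run/shared/lean/prim/rsw3/P1-QM.md` §27.  Helper file for the crux `stmt-CriticalPhenomena-4575`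
chain; no definitions, no sorries.

Let `ν` be an IIC measure (tail trivial, gen 10; one infinite cluster with finite bushes, gen 5/7 and `…IICBushes`) and `S_k ⊆ ℤ^d` a
RECEDING sequence of sets (eventually disjoint from every box).  The recurrence event `R = {C(0) meets S_k for infinitely many k}` is
not a tail event, but it is APPROXIMATELY FAR-MEASURABLE: for every `K` it agrees, up to a set of measure `≤ δ`, with the `𝓕_{Λ(K)ᶜ}`-event
"infinitely many `S_k` contain a site percolating in `ω ∖ E⁺(Λ(K))`".  Under tail triviality such events are trivial:

* **`real_eq_zero_or_one_of_isTailTrivial_of_approx`** — if `ν` is tail trivial and `A` is, for every `K` and `δ > 0`, within `δ` of a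
  measurable event determined off `Λ(K).sym2`, then `ν(A) ∈ {0,1}` (`|ν(A) − ν(A)²| ≤ 3δ + ε` by short-range correlations);
* `determinedBy_setOf_frequently`, `measurableSet_setOf_frequently` — bookkeeping for `{ω | ∃ᶠ k, ω ∈ W_k}`;
* **`iicMeasure_real_frequently_exists_openConn_eq_zero_or_one`** — **ZERO-ONE LAW**: `ν(C(0) meets S_k i.o.) ∈ {0,1}` for every receding
  `S_k` (`θ(p) = 0`, (A2)□ at aspect `(s,L)`, `2 ≤ s`); **`_criticalProbI`**, **`_Z2`**;
* **`iicMeasure_ae_frequently_exists_openConn_of_frequently_le`** — hence the SHARP recurrence criterion: if `ν(C(0) meets S_k) ≥ c > 0` for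
  INFINITELY MANY `k` (not necessarily all large `k`, cf. `…IICVisitsInfinitelyOften`), then `ν`-a.s. `C(0)` meets infinitely many `S_k`;
  and the convergence half `iicMeasure_ae_eventually_not_exists_openConn_of_summable` (`Σ_k ν(C(0) meets S_k) < ∞ ⇒` a.s. finitely many).

References: H.-O. Georgii, *Gibbs Measures and Phase Transitions* (2011), Prop. 7.9, Thm. 7.7; H. Kesten, PTRF 73 (1986) Thm. (3);
D. Basu, A. Sapozhnikov, ECP 22 (2017) no. 26; G. Grimmett, *Percolation* (1999), §8.2.
-/

noncomputable section

namespace Summit.CriticalPhenomena.PercolationContinuityZ3.Theorems.Crossing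

open MeasureTheory Filter Topology Literature.Probability.Percolation Literature.Probability.LatticeModels
open Literature.Probability.Percolation.DCT16 Literature.Probability.Percolation.DKT20
open Summit.CriticalPhenomena.PercolationContinuityZ3.Theorems.SurfaceTension
open scoped Literature.Probability.Percolation ENNReal symmDiff

variable {d : ℕ}

/-! ## Approximately far-measurable events are trivial under tail triviality -/

/-- **Approximately far-measurable events are trivial under a tail-trivial measure**: if `ν` is tail trivial, `A` is measurable and for
every `K` and `δ > 0` there is a measurable `G` determined by the pairs off `Λ(K).sym2` with `ν(A Δ G) ≤ δ`, then `ν(A) = 0` or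
`ν(A) = 1` — short-range correlations (Georgii Prop. 7.9) give `|ν(A ∩ G) − ν(A)ν(G)| ≤ ε`, whence `|ν(A) − ν(A)²| ≤ ε + 2δ`.
[cite: Georgii2011, Prop. 7.9] -/
theorem real_eq_zero_or_one_of_isTailTrivial_of_approx {ν : Measure (BondConfig (Site d))} [IsProbabilityMeasure ν]
    (hT : IsTailTrivial (V := Sym2 (Site d)) (S := Prop) ν) {A : Set (BondConfig (Site d))} (hA : MeasurableSet A)
    (happrox : ∀ (K : ℕ) (δ : ℝ), 0 < δ → ∃ G : Set (BondConfig (Site d)), MeasurableSet G ∧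
      DeterminedBy G {e : Sym2 (Site d) | e ∉ (↑((box d K).sym2) : Set (Sym2 (Site d)))} ∧ ν.real (A ∆ G) ≤ δ) :
    ν.real A = 0 ∨ ν.real A = 1 := by
  set x : ℝ := ν.real A with hx
  have hx0 : 0 ≤ x := measureReal_nonneg
  have hx1 : x ≤ 1 := measureReal_le_one
  have hsq : ∀ ε : ℝ, 0 < ε → |x - x * x| ≤ 3 * ε := by
    intro ε hε
    obtain ⟨K, hK⟩ := exists_forall_abs_real_inter_sub_mul_le_of_isTailTrivial hT hA hε
    obtain ⟨G, hGm, hGd, hAG⟩ := happrox K ε hε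
    have h1 := abs_le.1 (hK G hGm hGd)
    have h2 : |ν.real (A ∩ A) - ν.real (A ∩ G)| ≤ ε := by
      refine (abs_measureReal_sub_le_measureReal_symmDiff (hA.inter hA).nullMeasurableSet (hA.inter hGm).nullMeasurableSet).trans ?_
      rw [← Set.inter_symmDiff_distrib_left]
      exact (measureReal_mono Set.inter_subset_right).trans hAG
    rw [Set.inter_self] at h2
    have h3 : |ν.real A - ν.real G| ≤ ε :=
      (abs_measureReal_sub_le_measureReal_symmDiff hA.nullMeasurableSet hGm.nullMeasurableSet).trans hAG
    have h2' := abs_le.1 h2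
    have h3' := abs_le.1 h3
    rw [abs_le]
    constructor <;> nlinarith [h1.1, h1.2, h2'.1, h2'.2, h3'.1, h3'.2, hx0, hx1]
  have hzero : x - x * x = 0 := by
    by_contra hne
    have hpos : 0 < |x - x * x| := abs_pos.2 hne
    have h := hsq (|x - x * x| / 6) (by positivity)
    linarith
  have : x * (1 - x) = 0 := by linarith [hzero]
  rcases mul_eq_zero.1 this with h | h
  · exact Or.inl h
  · exact Or.inr (by linarith)

/-- `{ω | ∃ᶠ k, ω ∈ W_k}` is determined by `S` if every `W_k` is. [folklore] -/
theorem determinedBy_setOf_frequently {ι : Type*} {W : ℕ → Set (Set ι)} {S : Set ι} (h : ∀ k, DeterminedBy (W k) S) :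
    DeterminedBy {ω : Set ι | ∃ᶠ k in atTop, ω ∈ W k} S := by
  rw [determinedBy_iff]
  intro ω ω' hS
  simp only [Set.mem_setOf_eq]
  exact Filter.frequently_congr (Filter.Eventually.of_forall fun k => (determinedBy_iff _ _).1 (h k) ω ω' hS)

/-- `{ω | ∃ᶠ k, ω ∈ W_k} = ⋂_M ⋃_{k ≥ M} W_k` is measurable if every `W_k` is. [folklore] -/
theorem measurableSet_setOf_frequently {Ω : Type*} [MeasurableSpace Ω] {W : ℕ → Set Ω} (h : ∀ k, MeasurableSet (W k)) :
    MeasurableSet {ω : Ω | ∃ᶠ k in atTop, ω ∈ W k} := by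
  have : {ω : Ω | ∃ᶠ k in atTop, ω ∈ W k} = ⋂ M : ℕ, ⋃ k : ℕ, ⋃ (_ : M ≤ k), W k := by
    ext ω; simp only [Set.mem_setOf_eq, Filter.frequently_atTop, Set.mem_iInter, Set.mem_iUnion, exists_prop]
  rw [this]
  exact MeasurableSet.iInter fun M => MeasurableSet.iUnion fun k => MeasurableSet.iUnion fun _ => h k

/-! ## The zero-one law for recurrence to receding sets -/

/-- **ZERO-ONE LAW FOR THE RECURRENCE OF KESTEN'S IIC**: `θ(p) = 0`, (A2)□ at aspect `(s,L)` with `2 ≤ s`, `0 < p`, `d ≥ 1`, `ν` any IIC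
probability measure; for every sequence `S_k ⊆ ℤ^d` eventually disjoint from every box, `ν(C(0) meets S_k for infinitely many k)` is `0` or
`1`.  Proof: for every `K` the recurrence event agrees, off the null set where a site percolating off `Λ(K)` is not joined to `0` and off the
bush-far event of `Λ(K)` at a radius `r` with `S_k ∩ Λ(r) = ∅` for all large `k`, with the `𝓕_{Λ(K)ᶜ}`-event "infinitely many `S_k` contain
a site percolating in `ω ∖ E⁺(Λ(K))`"; then `real_eq_zero_or_one_of_isTailTrivial_of_approx`. [cite: Georgii2011, Prop. 7.9]
[cite: Kesten1986, Thm. (3)] [cite: BasuSapozhnikov2017ECP, Thm. 1.1] -/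
theorem iicMeasure_real_frequently_exists_openConn_eq_zero_or_one (hd : 1 ≤ d) (p : unitInterval) (hp : 0 < (p : ℝ))
    (hθ : theta (zdGraph d) 0 p = 0) {s L : ℕ} (hs : 2 ≤ s) {ϰ : ℝ} (hϰ : 0 < ϰ) (hA2 : SetToSetQuasiMultAspectAt d p s L ϰ)
    {ν : Measure (BondConfig (Site d))} [IsProbabilityMeasure ν]
    (hν : ∀ (F : Finset (Sym2 (Site d))) (E : Set (BondConfig (Site d))), MeasurableSet E → DeterminedBy E ↑F →
      Tendsto (fun n : ℕ => (bondPercolation (zdGraph d) p).real (E ∩ siteToBoundary d n) / oneArmProb d p n)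
        atTop (𝓝 (ν.real E)))
    (S : ℕ → Set (Site d)) (hS : ∀ r : ℕ, ∀ᶠ k in atTop, Disjoint (S k) ↑(box d r)) :
    ν.real {ω : BondConfig (Site d) | ∃ᶠ k in atTop, ∃ v ∈ S k, ω ∈ (openConn (0 : Site d) v : Set (BondConfig (Site d)))} = 0 ∨
      ν.real {ω : BondConfig (Site d) | ∃ᶠ k in atTop, ∃ v ∈ S k, ω ∈ (openConn (0 : Site d) v : Set (BondConfig (Site d)))} = 1 := by
  have hT := iicMeasure_isTailTrivial_of_setToSetQuasiMultAspectAt hd p hp hθ hs hϰ hA2 hν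
  have hae := iicMeasure_ae_openConn_of_percolatesAt_sdiff hd p hp hθ (by omega : 1 ≤ s) hϰ hA2 hν
  set U : ℕ → Set (BondConfig (Site d)) := fun k =>
    {ω | ∃ v ∈ S k, ω ∈ (openConn (0 : Site d) v : Set (BondConfig (Site d)))} with hU
  have hAm : MeasurableSet {ω : BondConfig (Site d) | ∃ᶠ k in atTop, ω ∈ U k} :=
    measurableSet_setOf_frequently fun k => measurableSet_exists_openConn _
  refine real_eq_zero_or_one_of_isTailTrivial_of_approx hT hAm fun K δ hδ => ?_
  set T : Set (Sym2 (Site d)) := {e : Sym2 (Site d) | ∃ w ∈ box d K, w ∈ e} with hTdef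
  set W : ℕ → Set (BondConfig (Site d)) := fun k =>
    {ω | ∃ v ∈ S k, ω \ T ∈ (percolatesAt v : Set (BondConfig (Site d)))} with hW
  -- radius `r` for the bush of `Λ(K)`, and `k₀` beyond which `S_k ∩ Λ(r) = ∅`
  have hfar := iicMeasure_tendsto_real_bushFar p hν K
  obtain ⟨r, hr⟩ := Filter.eventually_atTop.1 (hfar.eventually (ge_mem_nhds hδ))
  have hr' := hr r le_rfl
  obtain ⟨k₀, hk₀⟩ := Filter.eventually_atTop.1 (hS r)
  refine ⟨{ω | ∃ᶠ k in atTop, ω ∈ W k}, measurableSet_setOf_frequently fun k => measurableSet_exists_percolatesAt_sdiff (S k) T,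
    determinedBy_setOf_frequently fun k => determinedBy_exists_percolatesAt_sdiff_touching (S k) K, ?_⟩
  -- off the bush-far event and the null set, membership in `U_k` and `W_k` agree for all `k ≥ k₀`
  set E : Set (BondConfig (Site d)) := {ω : BondConfig (Site d) | ∃ v : Site d, v ∉ box d r ∧
      ω ∈ (openConn (0 : Site d) v : Set (BondConfig (Site d))) ∧ ω \ T ∉ (percolatesAt v : Set (BondConfig (Site d)))} with hE
  set N : Set (BondConfig (Site d)) := {ω | ¬ ∀ (T' : Set (Sym2 (Site d))) (v : Site d),
      ω \ T' ∈ (percolatesAt v : Set (BondConfig (Site d))) → ω ∈ (openConn (0 : Site d) v : Set (BondConfig (Site d)))} with hN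
  have hNnull : ν N = 0 := by
    refine measure_eq_zero_iff_ae_notMem.2 ?_
    filter_upwards [hae] with ω hω hωN
    exact hωN hω
  have hsub : {ω : BondConfig (Site d) | ∃ᶠ k in atTop, ω ∈ U k} ∆ {ω | ∃ᶠ k in atTop, ω ∈ W k} ⊆ E ∪ N := by
    intro ω hω
    by_contra hgood
    simp only [Set.mem_union, not_or] at hgood
    obtain ⟨hωE, hωN⟩ := hgood
    simp only [hN, Set.mem_setOf_eq, not_not] at hωN
    have hiff : ∀ k, k₀ ≤ k → (ω ∈ U k ↔ ω ∈ W k) := by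
      intro k hk
      constructor
      · rintro ⟨v, hv, h0v⟩
        refine ⟨v, hv, ?_⟩
        by_contra hpv
        exact hωE ⟨v, fun hvr => Set.disjoint_left.1 (hk₀ k hk) hv (Finset.mem_coe.2 hvr), h0v, hpv⟩
      · rintro ⟨v, hv, hpv⟩
        exact ⟨v, hv, hωN T v hpv⟩
    have hcongr : (∃ᶠ k in atTop, ω ∈ U k) ↔ ∃ᶠ k in atTop, ω ∈ W k :=
      Filter.frequently_congr (Filter.eventually_atTop.2 ⟨k₀, fun k hk => hiff k hk⟩)
    rcases hω with ⟨h1, h2⟩ | ⟨h1, h2⟩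
    · exact h2 (hcongr.1 h1)
    · exact h2 (hcongr.2 h1)
  calc ν.real ({ω : BondConfig (Site d) | ∃ᶠ k in atTop, ω ∈ U k} ∆ {ω | ∃ᶠ k in atTop, ω ∈ W k})
      ≤ ν.real (E ∪ N) := measureReal_mono hsub
    _ ≤ ν.real E + ν.real N := measureReal_union_le _ _
    _ ≤ δ + 0 := add_le_add hr' (le_of_eq ((measureReal_eq_zero_iff (measure_ne_top ν _)).2 hNnull))
    _ = δ := add_zero δ

/-- **The sharp recurrence criterion**: under the hypotheses of the zero-one law, if `ν(C(0) meets S_k) ≥ c > 0` for INFINITELY MANY `k`,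
then `ν`-a.s. `C(0)` meets `S_k` for infinitely many `k` (the recurrence event has probability `≥ c` along the tails `⋃_{k ≥ M} U_k`, hence is
not null, hence has probability one). [cite: Kesten1986, Thm. (3)] [cite: BasuSapozhnikov2017ECP, Thm. 1.1] [cite: Georgii2011, Prop. 7.9] -/
theorem iicMeasure_ae_frequently_exists_openConn_of_frequently_le (hd : 1 ≤ d) (p : unitInterval) (hp : 0 < (p : ℝ))
    (hθ : theta (zdGraph d) 0 p = 0) {s L : ℕ} (hs : 2 ≤ s) {ϰ : ℝ} (hϰ : 0 < ϰ) (hA2 : SetToSetQuasiMultAspectAt d p s L ϰ)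
    {ν : Measure (BondConfig (Site d))} [IsProbabilityMeasure ν]
    (hν : ∀ (F : Finset (Sym2 (Site d))) (E : Set (BondConfig (Site d))), MeasurableSet E → DeterminedBy E ↑F →
      Tendsto (fun n : ℕ => (bondPercolation (zdGraph d) p).real (E ∩ siteToBoundary d n) / oneArmProb d p n)
        atTop (𝓝 (ν.real E)))
    (S : ℕ → Set (Site d)) (hS : ∀ r : ℕ, ∀ᶠ k in atTop, Disjoint (S k) ↑(box d r)) {c : ℝ} (hc : 0 < c)
    (hcS : ∃ᶠ k in atTop, c ≤ ν.real {ω : BondConfig (Site d) | ∃ v ∈ S k, ω ∈ (openConn (0 : Site d) v : Set (BondConfig (Site d)))}) :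
    ∀ᵐ ω ∂ν, ∃ᶠ k in atTop, ∃ v ∈ S k, ω ∈ (openConn (0 : Site d) v : Set (BondConfig (Site d))) := by
  set U : ℕ → Set (BondConfig (Site d)) := fun k =>
    {ω | ∃ v ∈ S k, ω ∈ (openConn (0 : Site d) v : Set (BondConfig (Site d)))} with hU
  set A : Set (BondConfig (Site d)) := {ω | ∃ᶠ k in atTop, ω ∈ U k} with hA
  have hUm : ∀ k, MeasurableSet (U k) := fun k => measurableSet_exists_openConn _
  -- the tails `B_M = ⋃_{k ≥ M} U_k` decrease to `A` and have measure `≥ c`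
  set B : ℕ → Set (BondConfig (Site d)) := fun M => ⋃ k : ℕ, ⋃ (_ : M ≤ k), U k with hB
  have hBm : ∀ M, NullMeasurableSet (B M) ν := fun M =>
    (MeasurableSet.iUnion fun k => MeasurableSet.iUnion fun _ => hUm k).nullMeasurableSet
  have hBanti : Antitone B := by
    intro M M' hMM' ω hω
    simp only [hB, Set.mem_iUnion, exists_prop] at hω ⊢
    obtain ⟨k, hk, hωk⟩ := hω
    exact ⟨k, hMM'.trans hk, hωk⟩
  have hBA : (⋂ M, B M) = A := by
    ext ω; simp only [hA, hB, Set.mem_iInter, Set.mem_iUnion, Set.mem_setOf_eq, Filter.frequently_atTop, exists_prop]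
  have hlim := tendsto_measure_iInter_atTop hBm hBanti ⟨0, measure_ne_top ν _⟩
  rw [hBA] at hlim
  have hBc : ∀ M, ENNReal.ofReal c ≤ ν (B M) := by
    intro M
    obtain ⟨k, hk, hck⟩ := Filter.frequently_atTop.1 hcS M
    have hUB : U k ⊆ B M := fun ω hω => Set.mem_iUnion₂.2 ⟨k, hk, hω⟩
    calc ENNReal.ofReal c ≤ ENNReal.ofReal (ν.real (U k)) := ENNReal.ofReal_le_ofReal hck
      _ = ν (U k) := ofReal_measureReal (measure_ne_top ν _)
      _ ≤ ν (B M) := measure_mono hUB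
  have hAc : ENNReal.ofReal c ≤ ν A := ge_of_tendsto' hlim hBc
  have hApos : 0 < ν.real A := by
    rw [measureReal_def]
    exact ENNReal.toReal_pos (ne_of_gt (lt_of_lt_of_le (ENNReal.ofReal_pos.2 hc) hAc)) (measure_ne_top ν _)
  -- zero-one law: `ν(A) = 1`
  have h01 := iicMeasure_real_frequently_exists_openConn_eq_zero_or_one hd p hp hθ hs hϰ hA2 hν S hS
  have hA1 : ν.real A = 1 := by
    rcases h01 with h0 | h1
    · exact absurd h0 (ne_of_gt hApos)
    · exact h1
  have hAm : MeasurableSet A := measurableSet_setOf_frequently hUm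
  have hnull : ν Aᶜ = 0 := by
    rw [measure_compl hAm (measure_ne_top ν _), measure_univ]
    have : ν A = 1 := by
      rw [← ofReal_measureReal (measure_ne_top ν _), hA1, ENNReal.ofReal_one]
    rw [this]; exact tsub_self 1
  exact measure_mono_null (fun ω hω => hω) hnull

/-- **The convergence half**: if `Σ_k ν(C(0) meets S_k) < ∞` then `ν`-a.s. `C(0)` meets only finitely many `S_k` (first Borel–Cantelli; any
finite measure, any sets). [folklore] -/
theorem iicMeasure_ae_eventually_not_exists_openConn_of_summable (ν : Measure (BondConfig (Site d))) [IsFiniteMeasure ν]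
    (S : ℕ → Set (Site d))
    (hsum : Summable fun k => ν.real {ω : BondConfig (Site d) | ∃ v ∈ S k, ω ∈ (openConn (0 : Site d) v : Set (BondConfig (Site d)))}) :
    ∀ᵐ ω ∂ν, ∀ᶠ k in atTop, ¬ ∃ v ∈ S k, ω ∈ (openConn (0 : Site d) v : Set (BondConfig (Site d))) := by
  set U : ℕ → Set (BondConfig (Site d)) := fun k =>
    {ω | ∃ v ∈ S k, ω ∈ (openConn (0 : Site d) v : Set (BondConfig (Site d)))} with hU
  have h1 : ∀ k, ν (U k) ≤ ENNReal.ofReal (ν.real (U k)) := fun k => by rw [ofReal_measureReal (measure_ne_top ν _)]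
  have h2 : ∑' k, ν (U k) ≤ ∑' k, ENNReal.ofReal (ν.real (U k)) := ENNReal.tsum_le_tsum h1
  have h3 : ∑' k, ENNReal.ofReal (ν.real (U k)) = ENNReal.ofReal (∑' k, ν.real (U k)) :=
    (ENNReal.ofReal_tsum_of_nonneg (fun k => measureReal_nonneg) hsum).symm
  have h := ae_eventually_notMem (μ := ν) (s := U) (ne_top_of_le_ne_top (by rw [h3]; exact ENNReal.ofReal_ne_top) h2)
  filter_upwards [h] with ω hω
  exact hω.mono fun k hk hmem => hk hmem

/-! ## At `p_c(ℤ^d)` and on `ℤ²` -/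

/-- **Zero-one law and sharp recurrence at `p_c(ℤ^d)`** (`d ≥ 2`, (A2)□ at aspect `(s,L)`, `2 ≤ s`; every IIC probability measure `ν`;
every receding `S_k`): `ν(C(0) meets S_k i.o.) ∈ {0,1}`, and it is `1` as soon as `ν(C(0) meets S_k) ≥ c > 0` for infinitely many `k`.
[cite: BasuSapozhnikov2017ECP, Thm. 1.1] [cite: Kesten1986, Thm. (3)] [cite: Georgii2011, Prop. 7.9] -/
theorem iicMeasure_recurrence_zero_one_criticalProbI (hd : 2 ≤ d) {s L : ℕ} (hs : 2 ≤ s) {ϰ : ℝ} (hϰ : 0 < ϰ)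
    (hA2 : SetToSetQuasiMultAspectAt d (criticalProbI d) s L ϰ)
    {ν : Measure (BondConfig (Site d))} [IsProbabilityMeasure ν]
    (hν : ∀ (F : Finset (Sym2 (Site d))) (E : Set (BondConfig (Site d))), MeasurableSet E → DeterminedBy E ↑F →
      Tendsto (fun n : ℕ => (bondPercolation (zdGraph d) (criticalProbI d)).real (E ∩ siteToBoundary d n) /
        oneArmProb d (criticalProbI d) n) atTop (𝓝 (ν.real E)))
    (S : ℕ → Set (Site d)) (hS : ∀ r : ℕ, ∀ᶠ k in atTop, Disjoint (S k) ↑(box d r)) :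
    (ν.real {ω : BondConfig (Site d) | ∃ᶠ k in atTop, ∃ v ∈ S k, ω ∈ (openConn (0 : Site d) v : Set (BondConfig (Site d)))} = 0 ∨
      ν.real {ω : BondConfig (Site d) | ∃ᶠ k in atTop, ∃ v ∈ S k, ω ∈ (openConn (0 : Site d) v : Set (BondConfig (Site d)))} = 1) ∧
    ∀ c : ℝ, 0 < c →
      (∃ᶠ k in atTop, c ≤ ν.real {ω : BondConfig (Site d) | ∃ v ∈ S k, ω ∈ (openConn (0 : Site d) v : Set (BondConfig (Site d)))}) →
        ∀ᵐ ω ∂ν, ∃ᶠ k in atTop, ∃ v ∈ S k, ω ∈ (openConn (0 : Site d) v : Set (BondConfig (Site d))) := by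
  have hd1 : 1 ≤ d := by omega
  have hpc : 0 < ((criticalProbI d : unitInterval) : ℝ) := by rw [coe_criticalProbI]; exact criticalProb_zd_pos d hd1
  have hθ : theta (zdGraph d) 0 (criticalProbI d) = 0 := CSH.percolationContinuity_allDimensions d hd
  exact ⟨iicMeasure_real_frequently_exists_openConn_eq_zero_or_one hd1 (criticalProbI d) hpc hθ hs hϰ hA2 hν S hS,
    fun c hc hcS => iicMeasure_ae_frequently_exists_openConn_of_frequently_le hd1 (criticalProbI d) hpc hθ hs hϰ hA2 hν S hS hc hcS⟩

/-- **Zero-one law and sharp recurrence for Kesten's planar IIC, unconditionally** (every probability measure with the IIC limit property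
at `p_c(ℤ²)`; (A2)□ at aspect `(9,77)` by RSW). [cite: Kesten1986, Thm. (3)] [cite: Georgii2011, Prop. 7.9] -/
theorem iicMeasure_recurrence_zero_one_Z2 {ν : Measure (BondConfig (Site 2))} [IsProbabilityMeasure ν]
    (hν : ∀ (F : Finset (Sym2 (Site 2))) (E : Set (BondConfig (Site 2))), MeasurableSet E → DeterminedBy E ↑F →
      Tendsto (fun n : ℕ => (bondPercolation (zdGraph 2) (criticalProbI 2)).real (E ∩ siteToBoundary 2 n) /
        oneArmProb 2 (criticalProbI 2) n) atTop (𝓝 (ν.real E)))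
    (S : ℕ → Set (Site 2)) (hS : ∀ r : ℕ, ∀ᶠ k in atTop, Disjoint (S k) ↑(box 2 r)) :
    (ν.real {ω : BondConfig (Site 2) | ∃ᶠ k in atTop, ∃ v ∈ S k, ω ∈ (openConn (0 : Site 2) v : Set (BondConfig (Site 2)))} = 0 ∨
      ν.real {ω : BondConfig (Site 2) | ∃ᶠ k in atTop, ∃ v ∈ S k, ω ∈ (openConn (0 : Site 2) v : Set (BondConfig (Site 2)))} = 1) ∧
    ∀ c : ℝ, 0 < c →
      (∃ᶠ k in atTop, c ≤ ν.real {ω : BondConfig (Site 2) | ∃ v ∈ S k, ω ∈ (openConn (0 : Site 2) v : Set (BondConfig (Site 2)))}) →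
        ∀ᵐ ω ∂ν, ∃ᶠ k in atTop, ∃ v ∈ S k, ω ∈ (openConn (0 : Site 2) v : Set (BondConfig (Site 2))) := by
  obtain ⟨ϰ, hϰ, hA2⟩ := exists_setToSetQuasiMultAspectAt_two_of_criticalProbI_le
  exact iicMeasure_recurrence_zero_one_criticalProbI (d := 2) le_rfl (by norm_num) hϰ (hA2 _ le_rfl) hν S hS

end Summit.CriticalPhenomena.PercolationContinuityZ3.Theorems.Crossing

end
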